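import Literature.Claims.NS.Siche2026
import Literature.Analysis.FunctionSpaces.TorusFourierModes
import HarnessLib

/-!
# C135 `Siche2026` — the helical frame (gauge (39)) and helical coordinates of a single streamwise mode

For the parallel-shear mode `v(x) = Re (α e^{2πi n x₀}) ŷ` (`n > 0`, `α ∈ ℂ`, `α ≠ 0`) on the unit torus,
in the paper's gauge (39): `ê₁(±n e₀) = ±ŷ`, `ê₂ = ẑ`, the helical coordinates are
`c^σ_{n e₀} = α/(2√2)`, `c^σ_{-n e₀} = -ᾱ/(2√2)` (both sectors), every other mode is silent, and
`m_{n²}(x) = i·Im(α e^{2πinx₀})/|α|`, `χ_{n²}(x) = N_{n²} · Im(α e^{2πinx₀})² / |α|²`, `χ_K(x) = 0`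
for `K ≠ n²`.

WHAT THIS IS NOT: not a claim about NS regularity or blow-up; not a claim about any author beyond the
typed locator.
-/

set_option linter.dupNamespace false

noncomputable section

open Literature.Analysis.FunctionSpaces Literature.Analysis.FunctionSpaces.Torus
open Literature.Claims.NS.Siche2026
open UnitAddTorus (mFourier mFourierCoeff)
open scoped ComplexConjugate

namespace Summit.NavierStokesRegularity.NavierStokesRegularity.Theorems.Siche2026

/-- the streamwise wave vector `n e₀`. -/
def kx (n : ℤ) : Z3 := ![n, 0, 0]

/-- first coordinate of `n e₀`. [folklore] -/
@[simp] theorem kx_zero (n : ℤ) : kx n 0 = n := rfl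
/-- second coordinate of `n e₀`. [folklore] -/
@[simp] theorem kx_one (n : ℤ) : kx n 1 = 0 := rfl
/-- third coordinate of `n e₀`. [folklore] -/
@[simp] theorem kx_two (n : ℤ) : kx n 2 = 0 := rfl

/-- `-(n e₀) = (-n) e₀`. [folklore] -/
theorem neg_kx (n : ℤ) : -kx n = kx (-n) := by
  ext i; fin_cases i <;> simp [kx]

/-- `n ↦ n e₀` is injective. [folklore] -/
theorem kx_injective : Function.Injective kx := fun a b h => by
  have := congrFun h 0; simpa [kx] using this

/-- `n e₀ ≠ -n e₀` for `n ≠ 0`. [folklore] -/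
theorem kx_ne_neg {n : ℤ} (hn : n ≠ 0) : kx n ≠ -kx n := by
  rw [neg_kx]; intro h; have := kx_injective h; omega

/-- `|n e₀|² = n²`. [folklore] -/
theorem latticeNormSq_kx (n : ℤ) : latticeNormSq (kx n) = n ^ 2 := by
  simp [latticeNormSq, Fin.sum_univ_three, kx]

/-! ## The helical frame at `±n e₀` -/

/-- `|n e₀| = n` for `n > 0` (real Euclidean length). [folklore] -/
theorem len_kx {n : ℤ} (hn : 0 < n) : len (fun j => (kx n j : ℝ)) = n := by
  unfold len
  simp only [Fin.sum_univ_three, kx_zero, kx_one, kx_two, Int.cast_zero]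
  rw [show ((n : ℝ)) ^ 2 + (0:ℝ) ^ 2 + (0:ℝ) ^ 2 = (n : ℝ) ^ 2 by ring]
  exact Real.sqrt_sq (by exact_mod_cast hn.le)

/-- `k̂ = x̂` for `k = n e₀`, `n > 0`. [folklore] -/
theorem unitVec_kx {n : ℤ} (hn : 0 < n) : unitVec (kx n) = ![1, 0, 0] := by
  have hn' : (n : ℝ) ≠ 0 := by exact_mod_cast hn.ne'
  funext i
  unfold unitVec
  rw [len_kx hn]
  fin_cases i <;> simp [hn']

/-- `k̂ = -x̂` for `k = -n e₀`, `n > 0`. [folklore] -/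
theorem unitVec_kx_neg {n : ℤ} (hn : 0 < n) : unitVec (kx (-n)) = ![-1, 0, 0] := by
  have hn' : (n : ℝ) ≠ 0 := by exact_mod_cast hn.ne'
  have hlen : len (fun j => (kx (-n) j : ℝ)) = n := by
    unfold len
    simp only [Fin.sum_univ_three, kx_zero, kx_one, kx_two, Int.cast_zero, Int.cast_neg]
    rw [show (-(n : ℝ)) ^ 2 + (0:ℝ) ^ 2 + (0:ℝ) ^ 2 = (n : ℝ) ^ 2 by ring]
    exact Real.sqrt_sq (by exact_mod_cast hn.le)
  funext i
  unfold unitVec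
  rw [hlen]
  fin_cases i <;> simp [hn']

/-- `ẑ × (s x̂) = s ŷ`. [folklore] -/
theorem cross_zhat (s : ℝ) : cross ![0, 0, 1] ![s, 0, 0] = ![0, s, 0] := by
  unfold cross; funext i; fin_cases i <;> simp

/-- `|± ŷ| = 1`. [folklore] -/
theorem len_yhat (s : ℝ) (hs : s = 1 ∨ s = -1) : len ![0, s, 0] = 1 := by
  unfold len
  simp only [Fin.sum_univ_three, Matrix.cons_val_zero, Matrix.cons_val_one, Matrix.cons_val]
  rcases hs with rfl | rfl <;> simp

/-- gauge (39): `ê₁(k) = ẑ × k̂ / |ẑ × k̂| = s ŷ` when `k̂ = s x̂`, `s = ±1`. [cite: Siche2026, §6.6 (39) p. 15] -/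
theorem frame₁_of_unitVec {k : Z3} {s : ℝ} (hs : s = 1 ∨ s = -1) (hk : unitVec k = ![s, 0, 0]) :
    frame₁ k = ![0, s, 0] := by
  have hs0 : s ≠ 0 := by rcases hs with rfl | rfl <;> norm_num
  unfold frame₁
  rw [hk, cross_zhat]
  have hne : (![0, s, 0] : Fin 3 → ℝ) ≠ 0 := by
    intro h; have := congrFun h 1; simp [hs0] at this
  rw [if_neg hne, len_yhat s hs]
  funext i; simp

/-- gauge (39): `ê₂(k) = k̂ × ê₁(k) = ẑ` when `k̂ = s x̂`, `s = ±1`. [cite: Siche2026, §6.6 (39) p. 15] -/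
theorem frame₂_of_unitVec {k : Z3} {s : ℝ} (hs : s = 1 ∨ s = -1) (hk : unitVec k = ![s, 0, 0]) :
    frame₂ k = ![0, 0, 1] := by
  have hss : s * s = 1 := by rcases hs with rfl | rfl <;> norm_num
  unfold frame₂
  rw [frame₁_of_unitVec hs hk, hk]
  unfold cross; funext i; fin_cases i <;> simp [hss]

/-- `ê₁(n e₀) = ŷ` (`n > 0`). [cite: Siche2026, §6.6 (39) p. 15] -/
theorem frame₁_kx {n : ℤ} (hn : 0 < n) : frame₁ (kx n) = ![0, 1, 0] :=
  frame₁_of_unitVec (Or.inl rfl) (unitVec_kx hn)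

/-- `ê₂(n e₀) = ẑ` (`n > 0`). [cite: Siche2026, §6.6 (39) p. 15] -/
theorem frame₂_kx {n : ℤ} (hn : 0 < n) : frame₂ (kx n) = ![0, 0, 1] :=
  frame₂_of_unitVec (Or.inl rfl) (unitVec_kx hn)

/-- `ê₁(-n e₀) = -ŷ` (`n > 0`). [cite: Siche2026, §6.6 (39) p. 15] -/
theorem frame₁_kx_neg {n : ℤ} (hn : 0 < n) : frame₁ (kx (-n)) = ![0, -1, 0] :=
  frame₁_of_unitVec (Or.inr rfl) (unitVec_kx_neg hn)

/-- `ê₂(-n e₀) = ẑ` (`n > 0`). [cite: Siche2026, §6.6 (39) p. 15] -/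
theorem frame₂_kx_neg {n : ℤ} (hn : 0 < n) : frame₂ (kx (-n)) = ![0, 0, 1] :=
  frame₂_of_unitVec (Or.inr rfl) (unitVec_kx_neg hn)

/-- the sign of helicity sector `σ` as a complex unit. -/
def sgn (σ : Bool) : ℂ := if σ then 1 else -1

/-- components of `h^σ_{±n e₀}`: `(0, ±1/√2, iσ/√2)`. -/
theorem hel_apply_of_frame {k : Z3} {s : ℝ} (h1 : frame₁ k = ![0, s, 0]) (h2 : frame₂ k = ![0, 0, 1])
    (σ : Bool) (i : Fin 3) :
    hel k σ i = ![0, (s : ℂ) / (Real.sqrt 2 : ℂ), Complex.I * sgn σ / (Real.sqrt 2 : ℂ)] i := by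
  unfold hel
  rw [PiLp.toLp_apply, h1, h2]
  fin_cases i <;> simp [sgn]

/-! ## The single streamwise mode and its helical coordinates -/

/-- the `ŷ`-polarised coefficient vector `(0, α, 0) ∈ ℂ³`. -/
def yC (α : ℂ) : C3 := WithLp.toLp 2 ![0, α, 0]

/-- components of `(0, α, 0)`. [folklore] -/
@[simp] theorem yC_apply (α : ℂ) (i : Fin 3) : yC α i = ![0, α, 0] i := rfl

/-- complex conjugation of `(0, α, 0)`. [folklore] -/
theorem conjVec_yC (α : ℂ) : EuclideanSpace.conjVec (yC α) = yC (conj α) := by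
  ext i; fin_cases i <;> simp [EuclideanSpace.conjVec_apply, yC]

/-- `(0, rα, 0) = r • (0, α, 0)`. [folklore] -/
theorem yC_smul (r α : ℂ) : yC (r * α) = r • yC α := by
  ext i; fin_cases i <;> simp [yC]

/-- **the single streamwise mode** `v(x) = Re (α e^{2πinx₀}) ŷ` as a real trigonometric polynomial. -/
def shearMode (n : ℤ) (α : ℂ) : T3 → E3 := realTrigPoly {kx n} fun _ => yC α

/-- its vector Fourier coefficients: `α/2 · ŷ` at `n e₀`, `ᾱ/2 · ŷ` at `-n e₀`, `0` elsewhere. -/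
theorem coeff_mode {n : ℤ} (hn : n ≠ 0) (α : ℂ) (k : Z3) :
    coeff (shearMode n α) k =
      if k = kx n then yC (α / 2) else if k = -kx n then yC (conj α / 2) else 0 := by
  unfold coeff shearMode
  rw [mFourierCoeff_realTrigPoly_singleton]
  by_cases h1 : k = kx n
  · subst h1
    rw [if_pos rfl, if_neg (kx_ne_neg hn), if_pos rfl, EuclideanSpace.conjVec_zero, add_zero,
      show α / 2 = 2⁻¹ * α by ring, yC_smul]
  · rw [if_neg h1, if_neg h1, zero_add]
    by_cases h2 : k = -kx n
    · rw [if_pos h2, if_pos h2, conjVec_yC, show conj α / 2 = 2⁻¹ * conj α by ring, yC_smul]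
    · rw [if_neg h2, if_neg h2, EuclideanSpace.conjVec_zero, smul_zero]

/-- helical coordinate against a `ŷ`-polarised coefficient, frame `(0, s, 0), (0, 0, 1)`. -/
theorem helCoeff_eq_of_frame {v : T3 → E3} {k : Z3} {s : ℝ} {β : ℂ} (h1 : frame₁ k = ![0, s, 0])
    (h2 : frame₂ k = ![0, 0, 1]) (hc : coeff v k = yC β) (σ : Bool) :
    helCoeff v k σ = (s : ℂ) / (Real.sqrt 2 : ℂ) * β := by
  unfold helCoeff
  rw [hc, PiLp.inner_apply]
  simp only [Fin.sum_univ_three, hel_apply_of_frame h1 h2, yC_apply]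
  simp [Complex.conj_ofReal]
  ring

/-- `c^σ_{n e₀} = α/(2√2)` for the mode, both sectors. [cite: Siche2026, §2.1 (4) p. 3; Definition 4.1 p. 7] -/
theorem helCoeff_mode_pos {n : ℤ} (hn : 0 < n) (α : ℂ) (σ : Bool) :
    helCoeff (shearMode n α) (kx n) σ = α / (2 * Real.sqrt 2) := by
  rw [helCoeff_eq_of_frame (frame₁_kx hn) (frame₂_kx hn)
    (by rw [coeff_mode hn.ne', if_pos rfl]) σ]
  push_cast
  field_simp

/-- `c^σ_{-n e₀} = -ᾱ/(2√2)` for the mode, both sectors. [cite: Siche2026, §2.1 (4) p. 3; Definition 4.1 p. 7] -/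
theorem helCoeff_mode_neg {n : ℤ} (hn : 0 < n) (α : ℂ) (σ : Bool) :
    helCoeff (shearMode n α) (-kx n) σ = -(conj α / (2 * Real.sqrt 2)) := by
  have e1 : frame₁ (-kx n) = ![0, (-1 : ℝ), 0] := by rw [neg_kx]; exact frame₁_kx_neg hn
  have e2 : frame₂ (-kx n) = ![0, 0, 1] := by rw [neg_kx]; exact frame₂_kx_neg hn
  have h := helCoeff_eq_of_frame (v := shearMode n α) (σ := σ) (β := conj α / 2) e1 e2
    (by rw [coeff_mode hn.ne', if_neg (kx_ne_neg hn.ne').symm, if_pos rfl])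
  rw [h]
  push_cast
  field_simp

/-- every mode other than `±n e₀` is silent. [folklore] -/
theorem helCoeff_mode_eq_zero {n : ℤ} (hn : n ≠ 0) (α : ℂ) {k : Z3} (h1 : k ≠ kx n) (h2 : k ≠ -kx n)
    (σ : Bool) : helCoeff (shearMode n α) k σ = 0 := by
  unfold helCoeff
  rw [coeff_mode hn, if_neg h1, if_neg h2, inner_zero_right]


end Summit.NavierStokesRegularity.NavierStokesRegularity.Theorems.Siche2026
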